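import Literature.Geometry.Kaehler.HodgeStarProofs

/-!
# The pointwise Hodge star is injective (proof)

This file discharges the named fact `Literature.Geometry.Kaehler.hodgeStar_injective` of
`Literature/Geometry/Kaehler/HodgeStar.lean`:

* `Literature.Geometry.Kaehler.hodgeStar_injective_holds : hodgeStar_injective o` — for degrees
  `k + m = n`, the Hodge star `⋆ : Λᵏ V* → Λᵐ V*` of an oriented `n`-dimensional real inner
  product space `V` is injective;
* `Literature.Geometry.Kaehler.hodgeStar_bijective` — indeed it is bijective (the corollary
  promised in the docstring of the fact).

Source: F. W. Warner, *Foundations of Differentiable Manifolds and Lie Groups*, GTM 94, Ch. 2,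
Exercise 13, pp. 79–80: star is "a linear transformation `* : Λ(V) → Λ(V)`" (2) with
`* : Λ_p(V) → Λ_{n-p}(V)` (4), and item (5), p. 80: "Prove that on `Λ_p(V)`, `** = (-1)^{p(n-p)}`"
(recalled as 4.10 (6) and 6.1 (1), p. 220). Since `(-1)^{p(n-p)}` is a unit, (5) exhibits a
two-sided inverse of `*` up to sign, so `*` is injective (and bijective) in every degree; the fact
`hodgeStar_injective` vendors the injectivity half, which is what the manifold layer uses.

(Kept in its own file, downstream of `HodgeStarProofs.lean` where `⋆⋆ = (-1)^{km}` is proved, so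
that whole-file updates of that module cannot drop it; `HodgeStar.lean` itself cannot host the
proof without an import cycle.)

## Proof

Exactly the interim proof preserved (commented) under the fact in `HodgeStar.lean`: if
`⋆α = ⋆β` in degree `m`, apply `⋆` in the complementary degrees `m + k = n` and rewrite both sides
with `hodgeStar_hodgeStar_holds` (`⋆⋆ = (-1)^{km}`), giving `(-1)^{km} • α = (-1)^{km} • β`; cancel
the nonzero scalar (`smul_right_injective`). Surjectivity: `γ = ⋆((-1)^{mk} • ⋆γ)` by the same
identity in degrees `(m, k)`.

## References

* F. W. Warner, *Foundations of Differentiable Manifolds and Lie Groups*, GTM 94, Springer (1983),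
  Ch. 2, Exercise 13 (2)–(5), pp. 79–80; 4.10 (6); 6.1 (1), p. 220.
-/

noncomputable section

open Module ContinuousAlternatingMap Function

namespace Literature.Geometry.Kaehler

section HodgeStar

variable {V : Type*} [NormedAddCommGroup V] [InnerProductSpace ℝ V] [FiniteDimensional ℝ V]
  {n : ℕ} [Fact (finrank ℝ V = n)] (o : Orientation ℝ V (Fin n)) {k m : ℕ}

/-- **Discharge of `hodgeStar_injective`**: the Hodge star `⋆ : Λᵏ V* → Λᵐ V*` (`k + m = n`) of
an oriented `n`-dimensional real inner product space is injective. Warner, *Foundations of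
Differentiable Manifolds and Lie Groups*, GTM 94, Ch. 2, Exercise 13 (5), p. 80: "on `Λ_p(V)`,
`** = (-1)^{p(n-p)}`" (recalled as 6.1 (1), p. 220), so `*` has a two-sided inverse up to the
sign `(-1)^{p(n-p)}` and in particular is injective; here from `hodgeStar_hodgeStar_holds` by
cancelling the nonzero scalar `(-1)^{km}`.
[cite: WarnerGTM94, Ch. 2 Ex. 13 (5), p. 80; 6.1 (1), p. 220] -/
theorem hodgeStar_injective_holds : hodgeStar_injective o (k := k) (m := m) := by
  intro h α β hαβ
  have h' : m + k = n := by omega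
  have hc : ((-1 : ℝ) ^ (k * m)) ≠ 0 := pow_ne_zero _ (neg_ne_zero.2 one_ne_zero)
  have := congrArg (hodgeStar o h') hαβ
  rw [hodgeStar_hodgeStar_holds o h h' α, hodgeStar_hodgeStar_holds o h h' β] at this
  exact smul_right_injective _ hc this

/-- The Hodge star `⋆ : Λᵏ V* → Λᵐ V*` (`k + m = n`) is bijective: injective by
`hodgeStar_injective_holds`, surjective because `γ = ⋆((-1)^{mk} • ⋆γ)` for every `m`-form `γ`
(`⋆⋆ = (-1)^{mk}` in degrees `(m, k)`). Warner, *Foundations of Differentiable Manifolds and Lie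
Groups*, GTM 94, Ch. 2, Exercise 13 (2)–(5), pp. 79–80 (`*` is a linear transformation with
`** = (-1)^{p(n-p)}`, hence an isomorphism `Λ_p(V) → Λ_{n-p}(V)`).
[cite: WarnerGTM94, Ch. 2 Ex. 13 (5), p. 80] -/
theorem hodgeStar_bijective (h : k + m = n) : Bijective (hodgeStar o h) := by
  refine ⟨hodgeStar_injective_holds o h, fun γ ↦ ?_⟩
  have h' : m + k = n := by omega
  refine ⟨((-1 : ℝ) ^ (m * k)) • hodgeStar o h' γ, ?_⟩
  rw [map_smul, hodgeStar_hodgeStar_holds o h' h γ, smul_smul, ← mul_pow, neg_mul_neg, one_mul,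
    one_pow, one_smul]

end HodgeStar

end Literature.Geometry.Kaehler
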